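import Summits.BirchSwinnertonDyer.BirchSwinnertonDyer.Theorems.KimAtThreeFineKatoKPortSatLogMap
import Mathlib.FieldTheory.Galois.Basic
import Mathlib.RingTheory.Trace.Basic
import HarnessLib

/-!
# K-PORT glue (toward G7): Galois DESCENT of points of `E(K)`, the NORM `N(P) = ∑_σ σP` of a point, and
# the trace identity **`Tr_{K/ℚ_p}(Λ̃ P) = padicLog (P₀)` with `ι P₀ = N(P)`** for a finite Galois `K/ℚ_p`
# (cell `bsd-addord`, seat w2-kport gen 0; `--supports stmt-BirchSwinnertonDyer-19560`, helper)

HONEST FRAMING. Route W2 (`route-BirchSwinnertonDyer-KimAtThreeKolyvagin`), crux 19560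
`KatoKuriharaPortThreeShared`, residual ⟨C1⟩ clause (C1.c): kim3's CONSUMER THEOREM for SAT₀ (brief
KIM3-KPORT-BRIEF-g12 §3) is `∃ P ∈ E₀(K), Tr_{K/ℚ₃}(log P) ∈ ℤ₃ˣ ∧ ∀ Q ∈ E₀(K), ‖log Q‖ ≤ 1`, with the
proof sketch "`Tr(log P) = log(N P)`, `N : E₀(K)/E₁(K) → E₀(ℚ₃)/E₁(ℚ₃)` is `Tr_{k/𝔽₃}` under (P3), onto;
`λ_{ℚ₃}` injective". The second clause is `…KPortReduction`. This file supplies the first half of the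
first clause: for `K/ℚ_p` finite Galois (complete ultrametric normed `ℚ_p`-algebra), every `P ∈ E(K)`
has a NORM `N(P) = ∑_{σ ∈ Gal(K/ℚ_p)} σP` which is Galois-fixed, hence (DESCENT) of the form `ι P₀` with
`P₀ ∈ E(ℚ_p)`, and for `P ∈ Ẽ₁(K)` (e.g. `P ∈ E₀(K)` at additive reduction)
**`Tr_{K/ℚ_p}(Λ̃ P) = padicLog X P₀`** — the trace of the K-logarithm is n1011's `ℚ_p`-logarithm of the
descended norm point. What then remains of the consumer theorem is the RESIDUE-FIELD statement "some
`P ∈ E₀(K)` has `N(P) ∉ E₁(K)`" (reduction onto `k⁺` + `Tr_{k/𝔽_p}` onto; inventory (G5)/(G6)) and kim3's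
own (δ) at `ℚ₃` (`KimAtThreeFineKatoSATPoints`). TOOL theorems only (no definition, no named fact, no
`sorry`); closes nothing by itself; nothing booked.

## What is proved (`X = M ⊗ ℚ_p`, `E = curveK p K M`, `ι = Affine.Point.map (Algebra.ofId ℚ_[p] K)`,
`σP = Affine.Point.map σ P`)

* §1 DESCENT (any field extension, then Galois): `map_galois_eq_self_iff` (σ fixes `(x,y)` iff it fixes
  `x` and `y`), **`exists_map_ofId_eq_of_forall_map_eq`** (`K/ℚ_p` finite Galois: a point fixed by every
  `σ` is `ι P₀`, Mathlib `IsGalois.mem_range_algebraMap_iff_fixed` + `baseChange_nonsingular`),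
  `map_ofId_galois` (`σ (ι P₀) = ι P₀`).
* §2 NORM: `map_galois_sum_galois` (`τ N(P) = N(P)`), **`exists_map_ofId_eq_sum_galois`** (`N(P) = ι P₀`),
  `sum_galois_map_ofId` (`N(ι P₀) = [K:ℚ_p] • ι P₀`).
* §3 TRACE: **`algebraMap_trace_satLog`** (`algebraMap (Tr (Λ̃ P)) = Λ̃(N P)` on `Ẽ₁(K)`),
  **`trace_satLog_eq_padicLog`** (`Tr_{K/ℚ_p}(Λ̃ P) = padicLog X P₀` whenever `ι P₀ = N(P)`),
  `sum_galois_mem_kernel_iff` (`N(P) ∈ E₁(K) ↔ P₀ ∈ E₁(ℚ_p)`).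

References: J. H. Silverman, *The Arithmetic of Elliptic Curves*, 2nd ed. (2009), IV.6.4, VII.2
[SilvermanAEC2009]; kim3 brief HOME/kim3/KIM3-KPORT-BRIEF-g12.md §3 (consumer theorem).
-/

noncomputable section

-- the cell's Theorems namespace `Summit.BirchSwinnertonDyer.BirchSwinnertonDyer.…` repeats the summit name by design (D-0017)
set_option linter.dupNamespace false

open scoped Classical

namespace Summit.BirchSwinnertonDyer.BirchSwinnertonDyer.Theorems.KPort

open Summit.BirchSwinnertonDyer.Rank1Residual.Additive.BallEval
open Summit.BirchSwinnertonDyer.Rank1Residual.Additive.LocalLog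
open Literature.NumberTheory.GaloisRepresentations.LubinTate (unitBall mem_unitBall_iff)
open Literature.NumberTheory.EllipticCurves Literature.NumberTheory.EllipticCurves.FormalGroupChart
open WeierstrassCurve

variable {p : ℕ} [hp : Fact p.Prime] {K : Type*} [NontriviallyNormedField K] [NormedAlgebra ℚ_[p] K]
  {M : WeierstrassCurve ℤ_[p]}

/-! ## §1 Galois descent of points -/

section Descent

/-- `σ` fixes an affine point iff it fixes both coordinates. [folklore] -/
theorem map_galois_some_eq_self_iff (σ : K ≃ₐ[ℚ_[p]] K) {x y : K}
    (h : ((M.map PadicInt.Coe.ringHom).baseChange K).toAffine.Nonsingular x y) :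
    Affine.Point.map (W' := (M.map PadicInt.Coe.ringHom).toAffine) (σ : K →ₐ[ℚ_[p]] K) (.some x y h) =
        .some x y h ↔ σ x = x ∧ σ y = y := by
  rw [Affine.Point.map_some]
  constructor
  · intro e
    simp only [Affine.Point.some.injEq] at e
    exact e
  · rintro ⟨hx, hy⟩
    congr 1

/-- `ι P₀` is fixed by every `σ ∈ Gal(K/ℚ_p)`. [folklore] -/
theorem map_galois_map_ofId (σ : K ≃ₐ[ℚ_[p]] K) (P₀ : (M.map PadicInt.Coe.ringHom).toAffine.Point) :
    Affine.Point.map (W' := (M.map PadicInt.Coe.ringHom).toAffine) (σ : K →ₐ[ℚ_[p]] K)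
        (Affine.Point.map (W' := (M.map PadicInt.Coe.ringHom).toAffine) (Algebra.ofId ℚ_[p] K) P₀) =
      Affine.Point.map (W' := (M.map PadicInt.Coe.ringHom).toAffine) (Algebra.ofId ℚ_[p] K) P₀ := by
  rw [Affine.Point.map_map]
  congr 1
  ext x
  simp

variable [FiniteDimensional ℚ_[p] K] [IsGalois ℚ_[p] K]

/-- **Galois descent for points**: for `K/ℚ_p` finite Galois, a point of `E(K)` fixed by every
`σ ∈ Gal(K/ℚ_p)` comes from `E(ℚ_p)` (coordinatewise `IsGalois.mem_range_algebraMap_iff_fixed`; the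
`ℚ_p`-point is nonsingular by Mathlib's `baseChange_nonsingular`). [folklore] -/
theorem exists_map_ofId_eq_of_forall_map_eq {P : ((M.map PadicInt.Coe.ringHom).baseChange K).toAffine.Point}
    (hP : ∀ σ : K ≃ₐ[ℚ_[p]] K,
      Affine.Point.map (W' := (M.map PadicInt.Coe.ringHom).toAffine) (σ : K →ₐ[ℚ_[p]] K) P = P) :
    ∃ P₀ : (M.map PadicInt.Coe.ringHom).toAffine.Point,
      Affine.Point.map (W' := (M.map PadicInt.Coe.ringHom).toAffine) (Algebra.ofId ℚ_[p] K) P₀ = P := by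
  rcases P with _ | ⟨x, y, h⟩
  · exact ⟨0, rfl⟩
  · have hx : ∀ σ : K ≃ₐ[ℚ_[p]] K, σ x = x := fun σ => ((map_galois_some_eq_self_iff σ h).mp (hP σ)).1
    have hy : ∀ σ : K ≃ₐ[ℚ_[p]] K, σ y = y := fun σ => ((map_galois_some_eq_self_iff σ h).mp (hP σ)).2
    obtain ⟨x₀, rfl⟩ := (IsGalois.mem_range_algebraMap_iff_fixed x).mpr hx
    obtain ⟨y₀, rfl⟩ := (IsGalois.mem_range_algebraMap_iff_fixed y).mpr hy
    have h₀ : ((M.map PadicInt.Coe.ringHom).baseChange ℚ_[p]).toAffine.Nonsingular x₀ y₀ :=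
      ((M.map PadicInt.Coe.ringHom).toAffine.baseChange_nonsingular
        (f := Algebra.ofId ℚ_[p] K) (algebraMap ℚ_[p] K).injective x₀ y₀).mp h
    exact ⟨.some x₀ y₀ h₀, rfl⟩

end Descent

/-! ## §2 The norm `N(P) = ∑_σ σP` of a point -/

section Norm

variable [FiniteDimensional ℚ_[p] K]

/-- **`N(P) = ∑_σ σP` is Galois-fixed**: `τ N(P) = ∑_σ (τσ)P = N(P)`. [folklore] -/
theorem map_galois_sum_galois (τ : K ≃ₐ[ℚ_[p]] K) (P : ((M.map PadicInt.Coe.ringHom).baseChange K).toAffine.Point) :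
    Affine.Point.map (W' := (M.map PadicInt.Coe.ringHom).toAffine) (τ : K →ₐ[ℚ_[p]] K)
        (∑ σ : K ≃ₐ[ℚ_[p]] K,
          Affine.Point.map (W' := (M.map PadicInt.Coe.ringHom).toAffine) (σ : K →ₐ[ℚ_[p]] K) P) =
      ∑ σ : K ≃ₐ[ℚ_[p]] K,
        Affine.Point.map (W' := (M.map PadicInt.Coe.ringHom).toAffine) (σ : K →ₐ[ℚ_[p]] K) P := by
  rw [map_sum]
  simp_rw [Affine.Point.map_map]
  have hcomp : ∀ σ : K ≃ₐ[ℚ_[p]] K,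
      ((τ : K →ₐ[ℚ_[p]] K).comp (σ : K →ₐ[ℚ_[p]] K)) = ((τ * σ : K ≃ₐ[ℚ_[p]] K) : K →ₐ[ℚ_[p]] K) := by
    intro σ; ext x; rfl
  simp_rw [hcomp]
  exact Fintype.sum_equiv (Equiv.mulLeft τ) _ _ fun σ => rfl

variable [IsGalois ℚ_[p] K]

/-- **`N(P) = ι P₀` for some `P₀ ∈ E(ℚ_p)`** (descent of the Galois-fixed point `N(P)`). [folklore] -/
theorem exists_map_ofId_eq_sum_galois (P : ((M.map PadicInt.Coe.ringHom).baseChange K).toAffine.Point) :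
    ∃ P₀ : (M.map PadicInt.Coe.ringHom).toAffine.Point,
      Affine.Point.map (W' := (M.map PadicInt.Coe.ringHom).toAffine) (Algebra.ofId ℚ_[p] K) P₀ =
        ∑ σ : K ≃ₐ[ℚ_[p]] K,
          Affine.Point.map (W' := (M.map PadicInt.Coe.ringHom).toAffine) (σ : K →ₐ[ℚ_[p]] K) P :=
  exists_map_ofId_eq_of_forall_map_eq fun τ => map_galois_sum_galois τ P

omit [IsGalois ℚ_[p] K] in
/-- `N(ι P₀) = [K : ℚ_p] • ι P₀` (every `σ` fixes `ι P₀`; `#Gal = [K:ℚ_p]` for `K/ℚ_p` Galois is not needed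
in this raw form, which counts automorphisms). [folklore] -/
theorem sum_galois_map_ofId (P₀ : (M.map PadicInt.Coe.ringHom).toAffine.Point) :
    (∑ σ : K ≃ₐ[ℚ_[p]] K, Affine.Point.map (W' := (M.map PadicInt.Coe.ringHom).toAffine) (σ : K →ₐ[ℚ_[p]] K)
        (Affine.Point.map (W' := (M.map PadicInt.Coe.ringHom).toAffine) (Algebra.ofId ℚ_[p] K) P₀)) =
      Fintype.card (K ≃ₐ[ℚ_[p]] K) •
        Affine.Point.map (W' := (M.map PadicInt.Coe.ringHom).toAffine) (Algebra.ofId ℚ_[p] K) P₀ := by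
  simp_rw [map_galois_map_ofId]
  rw [Finset.sum_const, Finset.card_univ]

end Norm

/-! ## §3 The trace of the logarithm -/

section Trace

variable [IsUltrametricDist K] [CompleteSpace K] [FiniteDimensional ℚ_[p] K] [IsGalois ℚ_[p] K]
  [(curveK p K M).IsIntegral (NormedField.valuation (K := K)).integer] [(M.map PadicInt.Coe.ringHom).IsElliptic]

/-- **`Tr_{K/ℚ_p}(Λ̃ P) = Λ̃(N(P))` in `K`** for `P ∈ Ẽ₁(K)` (equivariance `Λ̃(σP) = σΛ̃(P)` summed over
`Gal(K/ℚ_p)`, and Mathlib's `trace_eq_sum_automorphisms`). [cite: SilvermanAEC2009, IV.6.4] -/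
theorem algebraMap_trace_satLog {P : (curveK p K M).toAffine.Point} (hP : P ∈ satKernel p K M) :
    algebraMap ℚ_[p] K (Algebra.trace ℚ_[p] K (satLog p K M P)) =
      satLog p K M (∑ σ : K ≃ₐ[ℚ_[p]] K,
        Affine.Point.map (W' := (M.map PadicInt.Coe.ringHom).toAffine) (σ : K →ₐ[ℚ_[p]] K) P) := by
  haveI : Algebra.IsAlgebraic ℚ_[p] K := Algebra.IsAlgebraic.of_finite ℚ_[p] K
  rw [trace_eq_sum_automorphisms, satLog_sum_galois Finset.univ hP]

omit [CompleteSpace K] [FiniteDimensional ℚ_[p] K] [IsGalois ℚ_[p] K] [(M.map PadicInt.Coe.ringHom).IsElliptic] in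
/-- `N(P) ∈ E₁(K) ↔ P₀ ∈ E₁(ℚ_p)` when `ι P₀ = N(P)` (`E₁(ℚ_p) = E₁(K) ∩ E(ℚ_p)`). [cite: SilvermanAEC2009, Prop. VII.2.2] -/
theorem sum_galois_mem_kernel_iff [FiniteDimensional ℚ_[p] K]
    [(M.map PadicInt.Coe.ringHom).IsIntegral (NormedField.valuation (K := ℚ_[p])).integer]
    {P : (curveK p K M).toAffine.Point} {P₀ : (M.map PadicInt.Coe.ringHom).toAffine.Point}
    (hP₀ : Affine.Point.map (W' := (M.map PadicInt.Coe.ringHom).toAffine) (Algebra.ofId ℚ_[p] K) P₀ =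
      ∑ σ : K ≃ₐ[ℚ_[p]] K,
        Affine.Point.map (W' := (M.map PadicInt.Coe.ringHom).toAffine) (σ : K →ₐ[ℚ_[p]] K) P) :
    (∑ σ : K ≃ₐ[ℚ_[p]] K,
        Affine.Point.map (W' := (M.map PadicInt.Coe.ringHom).toAffine) (σ : K →ₐ[ℚ_[p]] K) P) ∈
        kernel (NormedField.valuation (K := K)) (curveK p K M) ↔
      (M.map PadicInt.Coe.ringHom).IsInReductionKernel P₀ := by
  rw [← hP₀]
  exact map_ofId_mem_kernel_iff P₀

variable [(M.map PadicInt.Coe.ringHom).IsIntegral ℤ_[p]]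
  [(M.map PadicInt.Coe.ringHom).IsIntegral (NormedField.valuation (K := ℚ_[p])).integer]

/-- **`Tr_{K/ℚ_p}(Λ̃ P) = padicLog X P₀` whenever `ι P₀ = N(P)`** (`P ∈ Ẽ₁(K)`): the trace of the
K-logarithm is n1011's `ℚ_p`-logarithm of the descended norm point — kim3's "`Tr(log P) = log(N P)`".
[cite: SilvermanAEC2009, IV.6.4 and VII.6.3] -/
theorem trace_satLog_eq_padicLog {P : (curveK p K M).toAffine.Point} (hP : P ∈ satKernel p K M)
    {P₀ : (M.map PadicInt.Coe.ringHom).toAffine.Point}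
    (hP₀ : Affine.Point.map (W' := (M.map PadicInt.Coe.ringHom).toAffine) (Algebra.ofId ℚ_[p] K) P₀ =
      ∑ σ : K ≃ₐ[ℚ_[p]] K,
        Affine.Point.map (W' := (M.map PadicInt.Coe.ringHom).toAffine) (σ : K →ₐ[ℚ_[p]] K) P) :
    Algebra.trace ℚ_[p] K (satLog p K M P) = padicLog (M.map PadicInt.Coe.ringHom) P₀ := by
  apply (algebraMap ℚ_[p] K).injective
  rw [algebraMap_trace_satLog hP]
  refine (congrArg (satLog p K M) hP₀.symm).trans ?_
  exact satLog_map_ofId P₀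

end Trace

end Summit.BirchSwinnertonDyer.BirchSwinnertonDyer.Theorems.KPort

end
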